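import Literature.Analysis.FluidPDE.CarlemanDensity
import Literature.Analysis.FluidPDE.BackwardHeatInteriorGradient
import Literature.Analysis.FluidPDE.BackwardUniquenessCutoff
import HarnessLib

/-!
# The first Carleman inequality with cut-offs (core of Seregin 2014, Lemmas A.1–A.2)

Analysis/FluidPDE support file (theorems only) in the backward-uniqueness track of **ns.S08**
(`ess_backward_uniqueness`, ESS 2003 Thm. 5.1 = Seregin 2014, Thm. A.3.5). The proofs of
Seregin's Lemma A.1 (unique continuation across spatial boundaries) and Lemma A.2 (decay in a
half-space) both apply the first Carleman inequality (Prop. 1.2, (A.1.1), proved: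
`Carleman.carleman_inequality_first_of_contDiff_two`) to `w = η v`, `η = φ_ε(s) φ_t(s) φ_ρ(y)`,
absorb the term `c₁²λ² ∫ W(|w|² + |∇w|²)` coming from the inequality
`|∂ₛv + Δv| ≤ c₁λ(|∇v| + |v|)` into the left-hand side ((A.2.9), "choosing `γ` sufficiently
small"), and are left with an estimate of the weighted `L²` norm of `v` on the plateau of `η`
by weighted integrals over the regions where `∇η`, `∂ₛη` live ((A.2.10), (A.3.11)). This file
isolates that common step once and for all:

* `Carleman.core_first` — there are `κ > 0` and `C` (depending only on `dim E`) such that for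
  `v ∈ C²` near `[s₁, 7/4] × B̄(0, ρ - 1/2)` with `|∂ₛv + Δv| ≤ c(|v| + |∇v|)`, `c² ≤ κ`,
  `0 < s₁ < s₂ ≤ 1/2`, `ρ ≥ 2`, `a ≥ 2`, and every measurable `G ⊆ [s₂, 3/2] × B̄(0, ρ - 1)`,
  `∫_G W_a |v|² ≤ C ((s₂ - s₁)⁻² ∫_{[s₁,s₂]×B̄(0,ρ-1/2)} W_a |v|² + ∫_ω W_a (|v|² + |∇v|²))`,
  `W_a = h^{-2a}(s) e^{-|y|²/4s}` the Carleman weight (`Carleman.carlemanWeight`) and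
  `ω = ([3/2, 7/4] × B̄(0, ρ-1/2)) ∪ ([s₁, 7/4] × (B̄(0, ρ-1/2) ∖ B(0, ρ-1)))` the union of the top
  layer and the annulus.

All statements are proved; no definitions.

## References

* G. Seregin, *Lecture notes on regularity theory for the Navier–Stokes equations*, World
  Scientific 2014, App. A.2, proof of Lemma A.1, (A.2.7)–(A.2.10); App. A.3, proof of Lemma A.2,
  (A.3.11). [Seregin2014]
-/

noncomputable section

open MeasureTheory Set Function Filter Metric
open _root_.Topology
open scoped InnerProductSpace RealInnerProductSpace

namespace Literature.Analysis.FluidPDE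

namespace Carleman

section CoreFirst

variable {E : Type*} [NormedAddCommGroup E] [InnerProductSpace ℝ E] [FiniteDimensional ℝ E]
  [MeasurableSpace E] [BorelSpace E]
variable {F : Type*} [NormedAddCommGroup F] [InnerProductSpace ℝ F] [CompleteSpace F]

/-! #### Continuity and integrability helpers -/

omit [InnerProductSpace ℝ E] [FiniteDimensional ℝ E] [MeasurableSpace E] [BorelSpace E]
  [CompleteSpace F] in
/-- A product `g f` with `g` continuous and zero off a closed `K ⊆ Ω` (`Ω` open) and `f`
continuous on `Ω` is continuous. [folklore] -/
theorem continuous_mul_of_eq_zero_off {Ω K : Set (ℝ × E)} (hΩ : IsOpen Ω) (hK : IsClosed K)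
    (hKΩ : K ⊆ Ω) {g f : ℝ × E → ℝ} (hg : Continuous g) (hg0 : ∀ z ∉ K, g z = 0)
    (hf : ContinuousOn f Ω) : Continuous fun z => g z * f z :=
  continuous_of_continuousOn_of_eq_zero hΩ hK hKΩ (hg.continuousOn.mul hf) fun z hz => by
    simp [hg0 z hz]

omit [CompleteSpace F] in
/-- A continuous function which vanishes off a compact set is integrable. [folklore] -/
theorem integrable_of_continuous_of_eq_zero_off {K : Set (ℝ × E)} (hK : IsCompact K)
    {f : ℝ × E → ℝ} (hf : Continuous f) (hf0 : ∀ z ∉ K, f z = 0) : Integrable f :=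
  hf.integrable_of_hasCompactSupport (HasCompactSupport.of_support_subset_isCompact hK
    fun z hz => by by_contra h; exact hz (hf0 z h))

/-- Integration against an indicator weight: `∫ (𝟙_S c) f = c ∫_S f`. [folklore] -/
theorem integral_indicator_const_mul {S : Set (ℝ × E)} (hS : MeasurableSet S) (c : ℝ)
    (f : ℝ × E → ℝ) : ∫ z, S.indicator (fun _ => c) z * f z = c * ∫ z in S, f z := by
  rw [← integral_const_mul, ← integral_indicator hS]
  congr 1
  funext z
  by_cases hz : z ∈ S <;> simp [hz]

/-! #### The pointwise bound for `(∂ₛ + Δ)(η v)` -/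

omit [MeasurableSpace E] [BorelSpace E] [CompleteSpace F] in
/-- **Pointwise bound for the cut-off product** (Seregin 2014, (A.2.7), (A.3.11), squared): at a
point `z` of an open set `O` where `v ∈ C²(O)` satisfies `|∂ₛv + Δv| ≤ c(|v| + |∇v|)`, for
`η ∈ C²` with `η(z) ≥ 0` and `w = ηv`,
`|∂ₛw + Δw|² ≤ 6c²(|w|² + 2|∇w|² + 2|∇η|²|v|²) + 3(∂ₛη + Δη)²|v|² + 12|∇η|²|∇v|²`
(Leibniz rule, `(X+Y+Z)² ≤ 3(X²+Y²+Z²)`, `(|v| + |∇v|)² ≤ 2(|v|² + |∇v|²)` and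
`η²|∇v|² ≤ 2|∇w|² + 2|∇η|²|v|²`). [cite: Seregin2014, App. A.3, proof of Lemma A.2, (A.3.11)] -/
theorem norm_sq_dt_add_lap_smul_le {η : ℝ × E → ℝ} {v : ℝ × E → F} {O : Set (ℝ × E)} {c : ℝ}
    {z : ℝ × E} (hO : IsOpen O) (hη : ContDiff ℝ 2 η) (hv : ContDiffOn ℝ 2 v O) (hz : z ∈ O)
    (hη0 : 0 ≤ η z) (hBH : ‖dt v z + lap v z‖ ≤ c * (‖v z‖ + Real.sqrt (gradSq v z))) :
    ‖dt (fun y => η y • v y) z + lap (fun y => η y • v y) z‖ ^ 2 ≤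
      6 * c ^ 2 * (‖η z • v z‖ ^ 2 + 2 * gradSq (fun y => η y • v y) z +
        2 * gradSq η z * ‖v z‖ ^ 2) +
      3 * (dt η z + lap η z) ^ 2 * ‖v z‖ ^ 2 + 12 * gradSq η z * gradSq v z := by
  have hηd : DifferentiableAt ℝ η z := (hη.differentiable (by norm_num)) z
  have hvd : DifferentiableAt ℝ v z :=
    (hv.differentiableOn (by norm_num)).differentiableAt (hO.mem_nhds hz)
  -- Leibniz
  rw [dt_add_lap_smul_apply hO hη hv hz]
  -- the three pieces
  set X : ℝ := η z * ‖dt v z + lap v z‖ with hX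
  set Y : ℝ := |dt η z + lap η z| * ‖v z‖ with hY
  set Z : ℝ := 2 * (Real.sqrt (gradSq η z) * Real.sqrt (gradSq v z)) with hZ
  have hX0 : 0 ≤ X := mul_nonneg hη0 (norm_nonneg _)
  have hnorm : ‖η z • (dt v z + lap v z) + (dt η z + lap η z) • v z +
      (2 : ℝ) • ∑ i, dx (stdOrthonormalBasis ℝ E i) η z • dx (stdOrthonormalBasis ℝ E i) v z‖ ≤
      X + Y + Z := by
    refine (norm_add_le _ _).trans (add_le_add ((norm_add_le _ _).trans (add_le_add ?_ ?_)) ?_)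
    · rw [norm_smul, Real.norm_eq_abs, abs_of_nonneg hη0]
    · rw [norm_smul, Real.norm_eq_abs]
    · rw [norm_smul, Real.norm_eq_abs, abs_two]
      exact mul_le_mul_of_nonneg_left (norm_sum_dx_smul_dx_le η v z) zero_le_two
  have hsq : ‖η z • (dt v z + lap v z) + (dt η z + lap η z) • v z +
      (2 : ℝ) • ∑ i, dx (stdOrthonormalBasis ℝ E i) η z • dx (stdOrthonormalBasis ℝ E i) v z‖ ^ 2 ≤
      3 * (X ^ 2 + Y ^ 2 + Z ^ 2) :=
    (pow_le_pow_left₀ (norm_nonneg _) hnorm 2).trans (by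
      nlinarith [sq_nonneg (X - Y), sq_nonneg (Y - Z), sq_nonneg (X - Z)])
  -- `X² ≤ 2c²(‖w‖² + 2|∇w|² + 2|∇η|²‖v‖²)`
  have hXb : X ^ 2 ≤ 2 * c ^ 2 * (‖η z • v z‖ ^ 2 + 2 * gradSq (fun y => η y • v y) z +
      2 * gradSq η z * ‖v z‖ ^ 2) := by
    have h2 : X ^ 2 ≤ (η z * (c * (‖v z‖ + Real.sqrt (gradSq v z)))) ^ 2 :=
      pow_le_pow_left₀ hX0 (mul_le_mul_of_nonneg_left hBH hη0) 2
    have h3 : (‖v z‖ + Real.sqrt (gradSq v z)) ^ 2 ≤ 2 * (‖v z‖ ^ 2 + gradSq v z) := by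
      have := Real.sq_sqrt (gradSq_nonneg v z)
      nlinarith [sq_nonneg (‖v z‖ - Real.sqrt (gradSq v z))]
    have h4 : η z ^ 2 * gradSq v z ≤
        2 * gradSq (fun y => η y • v y) z + 2 * gradSq η z * ‖v z‖ ^ 2 := sq_mul_gradSq_le hηd hvd
    have h5 : ‖η z • v z‖ ^ 2 = η z ^ 2 * ‖v z‖ ^ 2 := by
      rw [norm_smul, Real.norm_eq_abs, mul_pow, sq_abs]
    calc X ^ 2 ≤ (η z * (c * (‖v z‖ + Real.sqrt (gradSq v z)))) ^ 2 := h2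
      _ = c ^ 2 * (η z ^ 2 * (‖v z‖ + Real.sqrt (gradSq v z)) ^ 2) := by ring
      _ ≤ c ^ 2 * (η z ^ 2 * (2 * (‖v z‖ ^ 2 + gradSq v z))) := by gcongr
      _ = 2 * c ^ 2 * (η z ^ 2 * ‖v z‖ ^ 2 + η z ^ 2 * gradSq v z) := by ring
      _ ≤ 2 * c ^ 2 * (η z ^ 2 * ‖v z‖ ^ 2 +
          (2 * gradSq (fun y => η y • v y) z + 2 * gradSq η z * ‖v z‖ ^ 2)) := by gcongr
      _ = 2 * c ^ 2 * (‖η z • v z‖ ^ 2 + 2 * gradSq (fun y => η y • v y) z +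
          2 * gradSq η z * ‖v z‖ ^ 2) := by rw [h5]; ring
  -- `Y² = (∂ₛη + Δη)² ‖v‖²`, `Z² = 4 |∇η|² |∇v|²`
  have hYb : Y ^ 2 = (dt η z + lap η z) ^ 2 * ‖v z‖ ^ 2 := by rw [hY, mul_pow, sq_abs]
  have hZb : Z ^ 2 = 4 * (gradSq η z * gradSq v z) := by
    rw [hZ, mul_pow, mul_pow, Real.sq_sqrt (gradSq_nonneg η z), Real.sq_sqrt (gradSq_nonneg v z)]
    ring
  calc _ ≤ 3 * (X ^ 2 + Y ^ 2 + Z ^ 2) := hsq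
    _ ≤ 3 * (2 * c ^ 2 * (‖η z • v z‖ ^ 2 + 2 * gradSq (fun y => η y • v y) z +
          2 * gradSq η z * ‖v z‖ ^ 2) + (dt η z + lap η z) ^ 2 * ‖v z‖ ^ 2 +
          4 * (gradSq η z * gradSq v z)) := by rw [← hYb, ← hZb]; gcongr
    _ = _ := by ring

/-! #### Integrability helpers for weighted cut-off integrands -/

omit [CompleteSpace F] in
/-- A weighted product `q g` with `g` continuous and zero off a compact `K ⊆ Ω` and the weight `q`
continuous on the open set `Ω` is integrable. [folklore] -/
theorem integrable_weight_mul {Ω K : Set (ℝ × E)} (hΩ : IsOpen Ω) (hKc : IsCompact K)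
    (hKΩ : K ⊆ Ω) {q g : ℝ × E → ℝ} (hq : ContinuousOn q Ω) (hg : Continuous g)
    (hg0 : ∀ z ∉ K, g z = 0) : Integrable fun z => q z * g z := by
  have hc : Continuous fun z => g z * q z :=
    continuous_mul_of_eq_zero_off hΩ hKc.isClosed hKΩ hg hg0 hq
  have hc' : Continuous fun z => q z * g z := by simpa only [mul_comm] using hc
  exact integrable_of_continuous_of_eq_zero_off hKc hc' fun z hz => by rw [hg0 z hz, mul_zero]

/-! #### The first Carleman inequality for a cut-off product -/

/-- **The first Carleman inequality for `w = ηv`, with the lower-order terms absorbed**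
(Seregin 2014, (A.2.8)–(A.2.10), (A.3.11)): let `0 < s₁`, `a ≥ 2`, `η ∈ C²` with
`tsupport η ⊆ [s₁, 7/4] × B̄(0, R)`, `η ≥ 0`, and `v ∈ C²(O)` on an open
`O ⊇ [s₁, 7/4] × B̄(0, R)` with `|∂ₛv + Δv| ≤ c(|v| + |∇v|)` on `O`, `c² ≤ 1/(24 c₀)`,
`c₀ = 11e^{4/3}` the constant of `carleman_inequality_first`. Then, with `W = h^{-2a}(s)e^{-|y|²/4s}`,
for every measurable `G` on which `η = 1`,
`∫_G W|v|² ≤ ∫ W|ηv|² ≤ ∫ W|∇η|²|v|² + 6c₀ ∫ W(∂ₛη + Δη)²|v|² + 24c₀ ∫ W|∇η|²|∇v|²`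
(all integrands on the right vanish off `tsupport η`). [cite: Seregin2014, App. A.3, proof of Lemma A.2, (A.3.11)] -/
theorem carleman_first_smul_le {η : ℝ × E → ℝ} {v : ℝ × E → F} {O : Set (ℝ × E)}
    {c a s₁ R : ℝ} (hO : IsOpen O) (hs₁ : 0 < s₁)
    (hKO : Icc s₁ (7 / 4) ×ˢ closedBall (0 : E) R ⊆ O) (hv : ContDiffOn ℝ 2 v O)
    (hBH : ∀ z ∈ O, ‖dt v z + lap v z‖ ≤ c * (‖v z‖ + Real.sqrt (gradSq v z)))
    (hcκ : c ^ 2 ≤ 1 / (24 * (11 * Real.exp (4 / 3)))) (ha : 2 ≤ a)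
    (hη : ContDiff ℝ 2 η) (hηc : HasCompactSupport η)
    (hηK : tsupport η ⊆ Icc s₁ (7 / 4) ×ˢ closedBall (0 : E) R) (hη0 : ∀ z, 0 ≤ η z)
    {G : Set (ℝ × E)} (hGm : MeasurableSet G) (hG1 : ∀ z ∈ G, η z = 1) :
    ∫ z in G, carlemanWeight a z * ‖v z‖ ^ 2 ≤
      (∫ z, carlemanWeight a z * (gradSq η z * ‖v z‖ ^ 2)) +
      6 * (11 * Real.exp (4 / 3)) *
        (∫ z, carlemanWeight a z * ((dt η z + lap η z) ^ 2 * ‖v z‖ ^ 2)) +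
      24 * (11 * Real.exp (4 / 3)) * ∫ z, carlemanWeight a z * (gradSq η z * gradSq v z) := by
  set c₀ : ℝ := 11 * Real.exp (4 / 3) with hc₀
  have hc₀0 : 0 < c₀ := by positivity
  -- ### geometry
  set K : Set (ℝ × E) := Icc s₁ (7 / 4) ×ˢ closedBall (0 : E) R with hK
  have hKc : IsCompact K := isCompact_Icc.prod (isCompact_closedBall _ _)
  set Ω : Set (ℝ × E) := {z | s₁ / 2 < z.1} with hΩ
  have hΩo : IsOpen Ω := isOpen_lt continuous_const continuous_fst
  have hKΩ : K ⊆ Ω := fun z hz => by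
    show s₁ / 2 < z.1
    linarith [hz.1.1]
  have hTc : IsCompact (tsupport η) := hηc
  have hTΩ : tsupport η ⊆ Ω := hηK.trans hKΩ
  have hTO : tsupport η ⊆ O := hηK.trans hKO
  set W : ℝ × E → ℝ := carlemanWeight a with hWdef
  have hWc : ContinuousOn W Ω := continuousOn_carlemanWeight a hs₁
  have hW0 : ∀ z ∈ Ω, 0 ≤ W z := fun z hz => (carlemanWeight_pos a (lt_trans (by positivity) hz)).le
  -- ### `w = η v`
  set w : ℝ × E → F := fun z => η z • v z with hw
  have hw0 : ∀ z ∉ tsupport η, w z = 0 := fun z hz => by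
    simp [hw, image_eq_zero_of_notMem_tsupport hz]
  have hwK : tsupport w ⊆ tsupport η := by
    refine closure_minimal (fun z hz => ?_) (isClosed_tsupport η)
    by_contra h
    exact hz (hw0 z h)
  have hw2 : ContDiff ℝ 2 w :=
    contDiff_of_contDiffOn_of_eq_zero hO (isClosed_tsupport η) hTO (hη.contDiffOn.smul hv) hw0
  have hwc : HasCompactSupport w := hηc.mono' ((subset_tsupport _).trans hwK)
  have hws : tsupport w ⊆ Ioo (0 : ℝ) 2 ×ˢ (univ : Set E) := by
    intro z hz
    have hzK := hηK (hwK hz)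
    exact ⟨⟨lt_of_lt_of_le hs₁ hzK.1.1, lt_of_le_of_lt hzK.1.2 (by norm_num)⟩, mem_univ _⟩
  -- ### vanishing off `tsupport η`
  have hηd0 : ∀ z ∉ tsupport η, fderiv ℝ η z = 0 := fun z hz =>
    fderiv_of_notMem_tsupport (𝕜 := ℝ) hz
  have hgη0 : ∀ z ∉ tsupport η, gradSq η z = 0 := fun z hz => by simp [gradSq, dx, hηd0 z hz]
  have hlapη0 : ∀ z ∉ tsupport η, lap η z = 0 := fun z hz =>
    image_eq_zero_of_notMem_tsupport fun h => hz (tsupport_lap_subset η h)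
  have hdtη0 : ∀ z ∉ tsupport η, dt η z = 0 := fun z hz => by simp [dt, hηd0 z hz]
  have hwd0 : ∀ z ∉ tsupport η, fderiv ℝ w z = 0 := fun z hz =>
    fderiv_of_notMem_tsupport (𝕜 := ℝ) fun h => hz (hwK h)
  have hgw0 : ∀ z ∉ tsupport η, gradSq w z = 0 := fun z hz => by simp [gradSq, dx, hwd0 z hz]
  have hlapw0 : ∀ z ∉ tsupport η, lap w z = 0 := fun z hz =>
    image_eq_zero_of_notMem_tsupport fun h => hz (hwK (tsupport_lap_subset w h))
  have hdtw0 : ∀ z ∉ tsupport η, dt w z = 0 := fun z hz => by simp [dt, hwd0 z hz]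
  have hPw0 : ∀ z ∉ tsupport η, dt w z + lap w z = 0 := fun z hz => by
    rw [hdtw0 z hz, hlapw0 z hz, add_zero]
  -- ### continuity
  have cw : Continuous w := hw2.continuous
  have cfd : ∀ {f : ℝ × E → F}, ContDiff ℝ 2 f → ∀ u : ℝ × E, Continuous fun z => fderiv ℝ f z u :=
    fun hf u => (hf.continuous_fderiv (by norm_num)).clm_apply continuous_const
  have cfd2 : ∀ {f : ℝ × E → F}, ContDiff ℝ 2 f → ∀ u u' : ℝ × E,
      Continuous fun z => fderiv ℝ (fun y => fderiv ℝ f y u) z u' := by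
    intro f hf u u'
    have h1 : ContDiff ℝ 1 fun y => fderiv ℝ f y u :=
      (hf.fderiv_right (m := 1) le_rfl).clm_apply contDiff_const
    exact (h1.continuous_fderiv one_ne_zero).clm_apply continuous_const
  have cfdr : ∀ {f : ℝ × E → ℝ}, ContDiff ℝ 2 f → ∀ u : ℝ × E, Continuous fun z => fderiv ℝ f z u :=
    fun hf u => (hf.continuous_fderiv (by norm_num)).clm_apply continuous_const
  have cfd2r : ∀ {f : ℝ × E → ℝ}, ContDiff ℝ 2 f → ∀ u u' : ℝ × E,
      Continuous fun z => fderiv ℝ (fun y => fderiv ℝ f y u) z u' := by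
    intro f hf u u'
    have h1 : ContDiff ℝ 1 fun y => fderiv ℝ f y u :=
      (hf.fderiv_right (m := 1) le_rfl).clm_apply contDiff_const
    exact (h1.continuous_fderiv one_ne_zero).clm_apply continuous_const
  have cPw : Continuous fun z => dt w z + lap w z := by
    simp only [dt, lap, dx]
    exact (cfd hw2 _).add (continuous_finsetSum _ fun i _ => cfd2 hw2 _ _)
  have cgw : Continuous (gradSq w) := by
    show Continuous fun z => gradSq w z
    simp only [gradSq, dx]
    exact continuous_finsetSum _ fun i _ => ((cfd hw2 _).norm.pow 2)
  have cPη : Continuous fun z => dt η z + lap η z := by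
    simp only [dt, lap, dx]
    exact (cfdr hη _).add (continuous_finsetSum _ fun i _ => cfd2r hη _ _)
  have cgη : Continuous (gradSq η) := by
    show Continuous fun z => gradSq η z
    simp only [gradSq, dx]
    exact continuous_finsetSum _ fun i _ => ((cfdr hη _).norm.pow 2)
  have cvO : ContinuousOn v O := hv.continuousOn
  have cgvO : ContinuousOn (gradSq v) O := by
    have hf : ContinuousOn (fderiv ℝ v) O := hv.continuousOn_fderiv_of_isOpen hO (by norm_num)
    show ContinuousOn (fun z => gradSq v z) O
    simp only [gradSq, dx]
    exact continuousOn_finsetSum _ fun i _ => ((hf.clm_apply continuousOn_const).norm.pow 2)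
  -- ### integrability of all the weighted integrands
  have iw : Integrable fun z => W z * ‖w z‖ ^ 2 :=
    integrable_weight_mul hΩo hTc hTΩ hWc (cw.norm.pow 2) fun z hz => by simp [hw0 z hz]
  have igw : Integrable fun z => W z * gradSq w z :=
    integrable_weight_mul hΩo hTc hTΩ hWc cgw hgw0
  have iPw : Integrable fun z => W z * ‖dt w z + lap w z‖ ^ 2 :=
    integrable_weight_mul hΩo hTc hTΩ hWc (cPw.norm.pow 2) fun z hz => by
      rw [hPw0 z hz]; simp
  have hWs : ContinuousOn (fun z : ℝ × E => W z * (a / z.1)) Ω :=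
    hWc.mul (continuousOn_const.div continuous_fst.continuousOn fun z hz =>
      (lt_trans (by positivity) hz : (0 : ℝ) < z.1).ne')
  have iws : Integrable fun z => W z * (a / z.1) * ‖w z‖ ^ 2 :=
    integrable_weight_mul hΩo hTc hTΩ hWs (cw.norm.pow 2) fun z hz => by simp [hw0 z hz]
  have iJ1 : Integrable fun z => W z * (gradSq η z * ‖v z‖ ^ 2) :=
    integrable_weight_mul hΩo hTc hTΩ hWc
      (continuous_mul_of_eq_zero_off hO (isClosed_tsupport η) hTO cgη hgη0 (cvO.norm.pow 2))
      fun z hz => by simp [hgη0 z hz]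
  have iJ2 : Integrable fun z => W z * ((dt η z + lap η z) ^ 2 * ‖v z‖ ^ 2) :=
    integrable_weight_mul hΩo hTc hTΩ hWc
      (continuous_mul_of_eq_zero_off hO (isClosed_tsupport η) hTO (cPη.pow 2)
        (fun z hz => by rw [hdtη0 z hz, hlapη0 z hz]; simp) (cvO.norm.pow 2))
      fun z hz => by rw [hdtη0 z hz, hlapη0 z hz]; simp
  have iJ3 : Integrable fun z => W z * (gradSq η z * gradSq v z) :=
    integrable_weight_mul hΩo hTc hTΩ hWc
      (continuous_mul_of_eq_zero_off hO (isClosed_tsupport η) hTO cgη hgη0 cgvO)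
      fun z hz => by simp [hgη0 z hz]
  -- ### the Carleman inequality and the lower bound of its left-hand side
  have hCarl := carleman_inequality_first_of_contDiff_two (E := E) (F := F)
    (by linarith : (0 : ℝ) < a) hw2 hwc hws
  have hLHS : (∫ z, W z * ‖w z‖ ^ 2) + (∫ z, W z * gradSq w z) ≤
      ∫ z, W z * (a / z.1 * ‖w z‖ ^ 2 + gradSq w z) := by
    have e0 : (∫ z, W z * ‖w z‖ ^ 2) + (∫ z, W z * gradSq w z) =
        ∫ z, (W z * ‖w z‖ ^ 2 + W z * gradSq w z) := (integral_add iw igw).symm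
    rw [e0]
    have e : (fun z => W z * (a / z.1 * ‖w z‖ ^ 2 + gradSq w z)) =
        fun z => W z * (a / z.1) * ‖w z‖ ^ 2 + W z * gradSq w z := by funext z; ring
    rw [e]
    refine integral_mono (iw.add igw) (iws.add igw) fun z => ?_
    by_cases hz : z ∈ tsupport η
    · have hzK := hηK hz
      have hWz : 0 ≤ W z := hW0 z (hKΩ hzK)
      have hs : 1 ≤ a / z.1 := by
        rw [le_div_iff₀ (lt_of_lt_of_le hs₁ hzK.1.1)]
        linarith [hzK.1.2]
      have h1 : W z * ‖w z‖ ^ 2 ≤ W z * (a / z.1) * ‖w z‖ ^ 2 := by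
        have := mul_le_mul_of_nonneg_left hs (mul_nonneg hWz (sq_nonneg ‖w z‖))
        linarith [this]
      exact add_le_add h1 le_rfl
    · simp [hw0 z hz]
  -- ### the pointwise bound and its integral
  have hP : ∀ z, W z * ‖dt w z + lap w z‖ ^ 2 ≤
      6 * c ^ 2 * (W z * ‖w z‖ ^ 2 + 2 * (W z * gradSq w z) +
        2 * (W z * (gradSq η z * ‖v z‖ ^ 2))) +
      3 * (W z * ((dt η z + lap η z) ^ 2 * ‖v z‖ ^ 2)) +
      12 * (W z * (gradSq η z * gradSq v z)) := by
    intro z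
    by_cases hz : z ∈ tsupport η
    · have hWz : 0 ≤ W z := hW0 z (hTΩ hz)
      have h := mul_le_mul_of_nonneg_left
        (norm_sq_dt_add_lap_smul_le hO hη hv (hTO hz) (hη0 z) (hBH z (hTO hz))) hWz
      refine h.trans (le_of_eq ?_)
      simp only [hw]
      ring
    · rw [hPw0 z hz, hw0 z hz, hgw0 z hz, hgη0 z hz, hdtη0 z hz, hlapη0 z hz]
      simp
  have hRHS : ∫ z, W z * ‖dt w z + lap w z‖ ^ 2 ≤
      6 * c ^ 2 * ((∫ z, W z * ‖w z‖ ^ 2) + 2 * (∫ z, W z * gradSq w z) +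
        2 * ∫ z, W z * (gradSq η z * ‖v z‖ ^ 2)) +
      3 * (∫ z, W z * ((dt η z + lap η z) ^ 2 * ‖v z‖ ^ 2)) +
      12 * ∫ z, W z * (gradSq η z * gradSq v z) := by
    have iA0 : Integrable fun z => W z * ‖w z‖ ^ 2 + 2 * (W z * gradSq w z) +
        2 * (W z * (gradSq η z * ‖v z‖ ^ 2)) := (iw.add (igw.const_mul 2)).add (iJ1.const_mul 2)
    have iA : Integrable fun z => 6 * c ^ 2 * (W z * ‖w z‖ ^ 2 + 2 * (W z * gradSq w z) +
        2 * (W z * (gradSq η z * ‖v z‖ ^ 2))) := iA0.const_mul _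
    have iB : Integrable fun z => 3 * (W z * ((dt η z + lap η z) ^ 2 * ‖v z‖ ^ 2)) :=
      iJ2.const_mul 3
    have iC : Integrable fun z => 12 * (W z * (gradSq η z * gradSq v z)) := iJ3.const_mul 12
    have hmono : ∫ z, W z * ‖dt w z + lap w z‖ ^ 2 ≤
        ∫ z, (6 * c ^ 2 * (W z * ‖w z‖ ^ 2 + 2 * (W z * gradSq w z) +
          2 * (W z * (gradSq η z * ‖v z‖ ^ 2))) +
          3 * (W z * ((dt η z + lap η z) ^ 2 * ‖v z‖ ^ 2)) +
          12 * (W z * (gradSq η z * gradSq v z))) := integral_mono iPw ((iA.add iB).add iC) hP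
    have e1a : ∫ z, (6 * c ^ 2 * (W z * ‖w z‖ ^ 2 + 2 * (W z * gradSq w z) +
        2 * (W z * (gradSq η z * ‖v z‖ ^ 2))) +
        3 * (W z * ((dt η z + lap η z) ^ 2 * ‖v z‖ ^ 2)) +
        12 * (W z * (gradSq η z * gradSq v z))) =
        (∫ z, (6 * c ^ 2 * (W z * ‖w z‖ ^ 2 + 2 * (W z * gradSq w z) +
          2 * (W z * (gradSq η z * ‖v z‖ ^ 2))) +
          3 * (W z * ((dt η z + lap η z) ^ 2 * ‖v z‖ ^ 2)))) +
        ∫ z, 12 * (W z * (gradSq η z * gradSq v z)) := integral_add (iA.add iB) iC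
    have e1b : ∫ z, (6 * c ^ 2 * (W z * ‖w z‖ ^ 2 + 2 * (W z * gradSq w z) +
          2 * (W z * (gradSq η z * ‖v z‖ ^ 2))) +
          3 * (W z * ((dt η z + lap η z) ^ 2 * ‖v z‖ ^ 2))) =
        (∫ z, 6 * c ^ 2 * (W z * ‖w z‖ ^ 2 + 2 * (W z * gradSq w z) +
          2 * (W z * (gradSq η z * ‖v z‖ ^ 2)))) +
        ∫ z, 3 * (W z * ((dt η z + lap η z) ^ 2 * ‖v z‖ ^ 2)) := integral_add iA iB
    have e2a : ∫ z, 6 * c ^ 2 * (W z * ‖w z‖ ^ 2 + 2 * (W z * gradSq w z) +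
        2 * (W z * (gradSq η z * ‖v z‖ ^ 2))) =
        6 * c ^ 2 * ∫ z, (W z * ‖w z‖ ^ 2 + 2 * (W z * gradSq w z) +
          2 * (W z * (gradSq η z * ‖v z‖ ^ 2))) := integral_const_mul _ _
    have e2b : ∫ z, (W z * ‖w z‖ ^ 2 + 2 * (W z * gradSq w z) +
        2 * (W z * (gradSq η z * ‖v z‖ ^ 2))) =
        (∫ z, (W z * ‖w z‖ ^ 2 + 2 * (W z * gradSq w z))) +
          ∫ z, 2 * (W z * (gradSq η z * ‖v z‖ ^ 2)) :=
      integral_add (iw.add (igw.const_mul 2)) (iJ1.const_mul 2)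
    have e2c : ∫ z, (W z * ‖w z‖ ^ 2 + 2 * (W z * gradSq w z)) =
        (∫ z, W z * ‖w z‖ ^ 2) + ∫ z, 2 * (W z * gradSq w z) := integral_add iw (igw.const_mul 2)
    have e2d : ∫ z, 2 * (W z * gradSq w z) = 2 * ∫ z, W z * gradSq w z := integral_const_mul _ _
    have e2e : ∫ z, 2 * (W z * (gradSq η z * ‖v z‖ ^ 2)) =
        2 * ∫ z, W z * (gradSq η z * ‖v z‖ ^ 2) := integral_const_mul _ _
    have e3 : ∫ z, 3 * (W z * ((dt η z + lap η z) ^ 2 * ‖v z‖ ^ 2)) =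
        3 * ∫ z, W z * ((dt η z + lap η z) ^ 2 * ‖v z‖ ^ 2) := integral_const_mul _ _
    have e4 : ∫ z, 12 * (W z * (gradSq η z * gradSq v z)) =
        12 * ∫ z, W z * (gradSq η z * gradSq v z) := integral_const_mul _ _
    rw [e1a, e1b, e2a, e2b, e2c, e2d, e2e, e3, e4] at hmono
    exact hmono
  -- ### absorption
  have hI0w : 0 ≤ ∫ z, W z * ‖w z‖ ^ 2 := integral_nonneg fun z => by
    by_cases hz : z ∈ tsupport η
    · exact mul_nonneg (hW0 z (hTΩ hz)) (sq_nonneg _)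
    · simp [hw0 z hz]
  have hI0g : 0 ≤ ∫ z, W z * gradSq w z := integral_nonneg fun z => by
    by_cases hz : z ∈ tsupport η
    · exact mul_nonneg (hW0 z (hTΩ hz)) (gradSq_nonneg w z)
    · simp [hgw0 z hz]
  have hJ10 : 0 ≤ ∫ z, W z * (gradSq η z * ‖v z‖ ^ 2) := integral_nonneg fun z => by
    by_cases hz : z ∈ tsupport η
    · exact mul_nonneg (hW0 z (hTΩ hz)) (mul_nonneg (gradSq_nonneg η z) (sq_nonneg _))
    · simp [hgη0 z hz]
  have hJ20 : 0 ≤ ∫ z, W z * ((dt η z + lap η z) ^ 2 * ‖v z‖ ^ 2) := integral_nonneg fun z => by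
    by_cases hz : z ∈ tsupport η
    · exact mul_nonneg (hW0 z (hTΩ hz)) (mul_nonneg (sq_nonneg _) (sq_nonneg _))
    · rw [hdtη0 z hz, hlapη0 z hz]; simp
  have hJ30 : 0 ≤ ∫ z, W z * (gradSq η z * gradSq v z) := integral_nonneg fun z => by
    by_cases hz : z ∈ tsupport η
    · exact mul_nonneg (hW0 z (hTΩ hz)) (mul_nonneg (gradSq_nonneg η z) (gradSq_nonneg v z))
    · simp [hgη0 z hz]
  have hcc : 6 * c₀ * c ^ 2 ≤ 1 / 4 := by
    have h := mul_le_mul_of_nonneg_left hcκ (by positivity : (0 : ℝ) ≤ 6 * c₀)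
    rw [show 6 * c₀ * (1 / (24 * (11 * Real.exp (4 / 3)))) = 1 / 4 by
      rw [hc₀]; field_simp; ring] at h
    exact h
  have hchain := (hLHS.trans hCarl).trans (mul_le_mul_of_nonneg_left hRHS hc₀0.le)
  -- linear arithmetic in the six integrals
  set Iw := ∫ z, W z * ‖w z‖ ^ 2 with hIw
  set Ig := ∫ z, W z * gradSq w z with hIg
  set J1 := ∫ z, W z * (gradSq η z * ‖v z‖ ^ 2) with hJ1
  set J2 := ∫ z, W z * ((dt η z + lap η z) ^ 2 * ‖v z‖ ^ 2) with hJ2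
  set J3 := ∫ z, W z * (gradSq η z * gradSq v z) with hJ3
  have hIP0 : 0 ≤ Iw + 2 * Ig + 2 * J1 := by linarith
  have h6 : c₀ * (6 * c ^ 2 * (Iw + 2 * Ig + 2 * J1)) ≤ (1 / 4) * (Iw + 2 * Ig + 2 * J1) := by
    have := mul_le_mul_of_nonneg_right hcc hIP0
    linarith [this]
  -- ### the left-hand side on `G`
  have hG : ∫ z in G, W z * ‖v z‖ ^ 2 ≤ Iw := by
    have e : ∫ z in G, W z * ‖v z‖ ^ 2 = ∫ z in G, W z * ‖w z‖ ^ 2 :=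
      setIntegral_congr_fun hGm fun z hz => by simp [hw, hG1 z hz]
    rw [e]
    refine setIntegral_le_integral iw (Eventually.of_forall fun z => ?_)
    by_cases hz : z ∈ tsupport η
    · exact mul_nonneg (hW0 z (hTΩ hz)) (sq_nonneg _)
    · simp [hw0 z hz]
  linarith [hchain, h6, hI0w, hI0g, hJ10, hJ20, hJ30, hG]

/-! #### The core estimate -/

omit [MeasurableSpace E] [BorelSpace E] [CompleteSpace F] in
/-- `(A + B + C)² ≤ 4A² + 4B² + 2C²`. [folklore] -/
theorem add_three_sq_le' (A B C : ℝ) : (A + B + C) ^ 2 ≤ 4 * A ^ 2 + 4 * B ^ 2 + 2 * C ^ 2 := by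
  nlinarith [sq_nonneg (A - B), sq_nonneg (A + B - C)]

set_option maxHeartbeats 800000 in
-- the assembly of many weighted integrals is long but elementary
/-- **First Carleman inequality with cut-offs** (the common core of Seregin 2014, Lemma A.1,
(A.2.7)–(A.2.10), and Lemma A.2, (A.3.11)): there are `κ > 0` and `C > 0`, depending only on
`dim E`, with the following property. Let `0 < s₁ < s₂ ≤ 1/2`, `ρ ≥ 2`, `a ≥ 2`; let `v` be `C²`
on an open set `O ⊇ [s₁, 7/4] × B̄(0, ρ - 1/2)` and satisfy there `|∂ₛv + Δv| ≤ c (|v| + |∇v|)`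
with `c² ≤ κ`. Then for every measurable `G ⊆ [s₂, 3/2] × B̄(0, ρ - 1)`,
`∫_G W|v|² ≤ C ((s₂ - s₁)⁻² ∫_{[s₁,s₂]×B̄(0,ρ-1/2)} W|v|² + ∫_ω W(|v|² + |∇v|²))`,
where `W = h^{-2a}(s)e^{-|y|²/4s}` is the Carleman weight and `ω` the union of the top layer
`[3/2, 7/4] × B̄(0, ρ-1/2)` and the annulus `[s₁, 7/4] × (B̄(0, ρ-1/2) ∖ B(0, ρ-1))`
(`carleman_first_smul_le` for the cut-off `η = φ_b φ_t φ_ρ` of `exists_cutoff_first`, and the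
pointwise bounds on `∂ₛη`, `∇η`, `Δη` there). [cite: Seregin2014, App. A.3, proof of Lemma A.2, (A.3.11)–(A.3.13)] -/
theorem core_first : ∃ κ C : ℝ, 0 < κ ∧ 0 < C ∧
    ∀ (c a s₁ s₂ ρ : ℝ) (v : ℝ × E → F) (O : Set (ℝ × E)),
      IsOpen O → Icc s₁ (7 / 4) ×ˢ closedBall (0 : E) (ρ - 1 / 2) ⊆ O → ContDiffOn ℝ 2 v O →
      (∀ z ∈ O, ‖dt v z + lap v z‖ ≤ c * (‖v z‖ + Real.sqrt (gradSq v z))) →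
      c ^ 2 ≤ κ → 0 < s₁ → s₁ < s₂ → s₂ ≤ 1 / 2 → 2 ≤ ρ → 2 ≤ a →
      ∀ G ⊆ Icc s₂ (3 / 2) ×ˢ closedBall (0 : E) (ρ - 1), MeasurableSet G →
      ∫ z in G, carlemanWeight a z * ‖v z‖ ^ 2 ≤
        C * ((s₂ - s₁)⁻¹ ^ 2 *
            (∫ z in Icc s₁ s₂ ×ˢ closedBall (0 : E) (ρ - 1 / 2), carlemanWeight a z * ‖v z‖ ^ 2) +
          ∫ z in (Icc (3 / 2) (7 / 4) ×ˢ closedBall (0 : E) (ρ - 1 / 2)) ∪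
              (Icc s₁ (7 / 4) ×ˢ (closedBall (0 : E) (ρ - 1 / 2) \ ball 0 (ρ - 1))),
            carlemanWeight a z * (‖v z‖ ^ 2 + gradSq v z)) := by
  obtain ⟨D, G₀, L, hD, hG₀, hL, hcut⟩ := exists_cutoff_first E
  set c₀ : ℝ := 11 * Real.exp (4 / 3) with hc₀
  have hc₀0 : 0 < c₀ := by positivity
  refine ⟨1 / (24 * c₀), 24 * c₀ * D ^ 2 + G₀ + 12 * c₀ * L ^ 2 + 24 * c₀ * G₀ + 1,
    by positivity, by positivity, ?_⟩
  intro c a s₁ s₂ ρ v O hO hKO hv hBH hcκ hs₁ hs₁₂ hs₂ hρ ha G hG hGm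
  -- ### the sets
  set K : Set (ℝ × E) := Icc s₁ (7 / 4) ×ˢ closedBall (0 : E) (ρ - 1 / 2) with hK
  set Sbot : Set (ℝ × E) := Icc s₁ s₂ ×ˢ closedBall (0 : E) (ρ - 1 / 2) with hSbot
  set Stop : Set (ℝ × E) := Icc (3 / 2 : ℝ) (7 / 4) ×ˢ closedBall (0 : E) (ρ - 1 / 2) with hStop
  set Sann : Set (ℝ × E) := Icc s₁ (7 / 4) ×ˢ (closedBall (0 : E) (ρ - 1 / 2) \ ball 0 (ρ - 1))
    with hSann
  have hKc : IsCompact K := isCompact_Icc.prod (isCompact_closedBall _ _)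
  have hbotK : Sbot ⊆ K := Set.prod_mono (Icc_subset_Icc_right (by linarith)) Subset.rfl
  have htopK : Stop ⊆ K := Set.prod_mono (Icc_subset_Icc_left (by linarith)) Subset.rfl
  have hannK : Sann ⊆ K := Set.prod_mono Subset.rfl Set.sdiff_subset
  have hbotm : MeasurableSet Sbot := measurableSet_Icc.prod measurableSet_closedBall
  have htopm : MeasurableSet Stop := measurableSet_Icc.prod measurableSet_closedBall
  have hannm : MeasurableSet Sann :=
    measurableSet_Icc.prod (measurableSet_closedBall.diff measurableSet_ball)
  have hunm : MeasurableSet (Stop ∪ Sann) := htopm.union hannm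
  set Ω : Set (ℝ × E) := {z | s₁ / 2 < z.1} with hΩ
  have hKΩ : K ⊆ Ω := fun z hz => by
    show s₁ / 2 < z.1
    linarith [hz.1.1]
  set W : ℝ × E → ℝ := carlemanWeight a with hWdef
  have hWc : ContinuousOn W Ω := continuousOn_carlemanWeight a hs₁
  have hW0 : ∀ z ∈ Ω, 0 ≤ W z := fun z hz => (carlemanWeight_pos a (lt_trans (by positivity) hz)).le
  -- ### the cut-off
  obtain ⟨η, hηs, hη1, hηK, hηc, hηnn, hηle, hηdt, hηgrad, hηlap⟩ := hcut s₁ s₂ ρ hs₁ hs₁₂ hρ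
  have hη2 : ContDiff ℝ 2 η := hηs.of_le (by norm_cast)
  have hηd0 : ∀ z ∉ tsupport η, fderiv ℝ η z = 0 := fun z hz =>
    fderiv_of_notMem_tsupport (𝕜 := ℝ) hz
  have hgη0 : ∀ z ∉ tsupport η, gradSq η z = 0 := fun z hz => by simp [gradSq, dx, hηd0 z hz]
  have hlapη0 : ∀ z ∉ tsupport η, lap η z = 0 := fun z hz =>
    image_eq_zero_of_notMem_tsupport fun h => hz (tsupport_lap_subset η h)
  have hdtη0 : ∀ z ∉ tsupport η, dt η z = 0 := fun z hz => by simp [dt, hηd0 z hz]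
  -- ### the Carleman estimate for `η v`
  have hmain := carleman_first_smul_le hO hs₁ hKO hv hBH hcκ ha hη2 hηc hηK hηnn hGm
    fun z hz => hη1 z (hG hz)
  -- ### integrability on `K`
  have cvO : ContinuousOn v O := hv.continuousOn
  have cgvO : ContinuousOn (gradSq v) O := by
    have hf : ContinuousOn (fderiv ℝ v) O := hv.continuousOn_fderiv_of_isOpen hO (by norm_num)
    show ContinuousOn (fun z => gradSq v z) O
    simp only [gradSq, dx]
    exact continuousOn_finsetSum _ fun i _ => ((hf.clm_apply continuousOn_const).norm.pow 2)
  have hWK : ContinuousOn W K := hWc.mono hKΩ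
  have hIvK : IntegrableOn (fun z => W z * ‖v z‖ ^ 2) K :=
    (hWK.mul ((cvO.mono hKO).norm.pow 2)).integrableOn_compact hKc
  have hIgK : IntegrableOn (fun z => W z * gradSq v z) K :=
    (hWK.mul (cgvO.mono hKO)).integrableOn_compact hKc
  have hind : ∀ {S : Set (ℝ × E)}, S ⊆ K → MeasurableSet S → ∀ (k : ℝ) {q : ℝ × E → ℝ},
      IntegrableOn (fun z => W z * q z) K →
      Integrable fun z => S.indicator (fun _ => k) z * (W z * q z) := by
    intro S hS hSm k q hq
    have h : Integrable (S.indicator fun z => k * (W z * q z)) :=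
      IntegrableOn.integrable_indicator ((hq.mono_set hS).const_mul k) hSm
    refine h.congr (Eventually.of_forall fun z => ?_)
    by_cases hz : z ∈ S <;> simp [hz]
  -- nonnegativity of indicator terms
  have hnn : ∀ {S : Set (ℝ × E)}, S ⊆ K → ∀ {k : ℝ}, 0 ≤ k → ∀ {q : ℝ × E → ℝ},
      (∀ z, 0 ≤ q z) → ∀ z, 0 ≤ S.indicator (fun _ => k) z * (W z * q z) := by
    intro S hS k hk q hq z
    by_cases hz : z ∈ S
    · rw [Set.indicator_of_mem hz]
      exact mul_nonneg hk (mul_nonneg (hW0 z (hKΩ (hS hz))) (hq z))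
    · simp [hz]
  -- the four region integrals
  set Tbot : ℝ := ∫ z in Sbot, W z * ‖v z‖ ^ 2 with hTbot
  set Ttop : ℝ := ∫ z in Stop, W z * ‖v z‖ ^ 2 with hTtop
  set Tann1 : ℝ := ∫ z in Sann, W z * ‖v z‖ ^ 2 with hTann1
  set Tann2 : ℝ := ∫ z in Sann, W z * gradSq v z with hTann2
  set U : ℝ := ∫ z in Stop ∪ Sann, W z * (‖v z‖ ^ 2 + gradSq v z) with hU
  -- ### (1) `J1 ≤ G₀ Tann1`
  have hJ1 : ∫ z, W z * (gradSq η z * ‖v z‖ ^ 2) ≤ G₀ * Tann1 := by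
    rw [hTann1, ← integral_indicator_const_mul hannm]
    refine integral_mono_of_nonneg (Eventually.of_forall fun z => ?_) (hind hannK hannm G₀ hIvK)
      (Eventually.of_forall fun z => ?_)
    · dsimp only
      by_cases hz : z ∈ tsupport η
      · exact mul_nonneg (hW0 z (hKΩ (hηK hz))) (mul_nonneg (gradSq_nonneg η z) (sq_nonneg _))
      · simp [hgη0 z hz]
    · dsimp only
      by_cases hz : z ∈ tsupport η
      · have hWz := hW0 z (hKΩ (hηK hz))
        have h := mul_le_mul_of_nonneg_right (hηgrad z) (mul_nonneg hWz (sq_nonneg ‖v z‖))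
        calc W z * (gradSq η z * ‖v z‖ ^ 2) = gradSq η z * (W z * ‖v z‖ ^ 2) := by ring
          _ ≤ _ := h
      · rw [hgη0 z hz]
        simpa using hnn hannK hG₀ (fun z => sq_nonneg ‖v z‖) z
  -- ### (2) `J3 ≤ G₀ Tann2`
  have hJ3 : ∫ z, W z * (gradSq η z * gradSq v z) ≤ G₀ * Tann2 := by
    rw [hTann2, ← integral_indicator_const_mul hannm]
    refine integral_mono_of_nonneg (Eventually.of_forall fun z => ?_) (hind hannK hannm G₀ hIgK)
      (Eventually.of_forall fun z => ?_)
    · dsimp only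
      by_cases hz : z ∈ tsupport η
      · exact mul_nonneg (hW0 z (hKΩ (hηK hz)))
          (mul_nonneg (gradSq_nonneg η z) (gradSq_nonneg v z))
      · simp [hgη0 z hz]
    · dsimp only
      by_cases hz : z ∈ tsupport η
      · have hWz := hW0 z (hKΩ (hηK hz))
        have h := mul_le_mul_of_nonneg_right (hηgrad z) (mul_nonneg hWz (gradSq_nonneg v z))
        calc W z * (gradSq η z * gradSq v z) = gradSq η z * (W z * gradSq v z) := by ring
          _ ≤ _ := h
      · rw [hgη0 z hz]
        simpa using hnn hannK hG₀ (fun z => gradSq_nonneg v z) z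
  -- ### (3) `J2 ≤ 4(D/(s₂-s₁))² Tbot + 4D² Ttop + 2L² Tann1`
  have hs21 : 0 < s₂ - s₁ := sub_pos.2 hs₁₂
  have hJ2 : ∫ z, W z * ((dt η z + lap η z) ^ 2 * ‖v z‖ ^ 2) ≤
      4 * ((D / (s₂ - s₁)) ^ 2 * Tbot) + 4 * (D ^ 2 * Ttop) + 2 * (L ^ 2 * Tann1) := by
    have i1 := hind hbotK hbotm ((D / (s₂ - s₁)) ^ 2) hIvK
    have i2 := hind htopK htopm (D ^ 2) hIvK
    have i3 := hind hannK hannm (L ^ 2) hIvK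
    have hmono : ∫ z, W z * ((dt η z + lap η z) ^ 2 * ‖v z‖ ^ 2) ≤
        ∫ z, (4 * (Sbot.indicator (fun _ => (D / (s₂ - s₁)) ^ 2) z * (W z * ‖v z‖ ^ 2)) +
          4 * (Stop.indicator (fun _ => D ^ 2) z * (W z * ‖v z‖ ^ 2)) +
          2 * (Sann.indicator (fun _ => L ^ 2) z * (W z * ‖v z‖ ^ 2))) := by
      refine integral_mono_of_nonneg (Eventually.of_forall fun z => ?_)
        (((i1.const_mul 4).add (i2.const_mul 4)).add (i3.const_mul 2))
        (Eventually.of_forall fun z => ?_)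
      · dsimp only
        by_cases hz : z ∈ tsupport η
        · exact mul_nonneg (hW0 z (hKΩ (hηK hz))) (mul_nonneg (sq_nonneg _) (sq_nonneg _))
        · rw [hdtη0 z hz, hlapη0 z hz]; simp
      · dsimp only
        have n1 := hnn hbotK (by positivity : 0 ≤ (D / (s₂ - s₁)) ^ 2) (fun z => sq_nonneg ‖v z‖) z
        have n2 := hnn htopK (by positivity : 0 ≤ D ^ 2) (fun z => sq_nonneg ‖v z‖) z
        have n3 := hnn hannK (by positivity : 0 ≤ L ^ 2) (fun z => sq_nonneg ‖v z‖) z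
        by_cases hz : z ∈ tsupport η
        swap
        · rw [hdtη0 z hz, hlapη0 z hz]
          simp only [add_zero, zero_pow two_ne_zero, zero_mul, mul_zero]
          positivity
        have hWz := hW0 z (hKΩ (hηK hz))
        -- squares of the indicator bounds
        have e1 : (Sbot.indicator (fun _ => D / (s₂ - s₁)) z) ^ 2 =
            Sbot.indicator (fun _ => (D / (s₂ - s₁)) ^ 2) z := by
          by_cases h : z ∈ Sbot <;> simp [h]
        have e2 : (Stop.indicator (fun _ => D) z) ^ 2 = Stop.indicator (fun _ => D ^ 2) z := by
          by_cases h : z ∈ Stop <;> simp [h]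
        have e3 : (Sann.indicator (fun _ => L) z) ^ 2 = Sann.indicator (fun _ => L ^ 2) z := by
          by_cases h : z ∈ Sann <;> simp [h]
        have hb : |dt η z + lap η z| ≤ Sbot.indicator (fun _ => D / (s₂ - s₁)) z +
            Stop.indicator (fun _ => D) z + Sann.indicator (fun _ => L) z :=
          (abs_add_le _ _).trans (add_le_add (hηdt z) (hηlap z))
        have hsq : (dt η z + lap η z) ^ 2 ≤
            4 * Sbot.indicator (fun _ => (D / (s₂ - s₁)) ^ 2) z +
            4 * Stop.indicator (fun _ => D ^ 2) z + 2 * Sann.indicator (fun _ => L ^ 2) z := by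
          rw [← e1, ← e2, ← e3, ← sq_abs (dt η z + lap η z)]
          exact (pow_le_pow_left₀ (abs_nonneg _) hb 2).trans (add_three_sq_le' _ _ _)
        have := mul_le_mul_of_nonneg_right hsq (mul_nonneg hWz (sq_nonneg ‖v z‖))
        calc W z * ((dt η z + lap η z) ^ 2 * ‖v z‖ ^ 2)
            = (dt η z + lap η z) ^ 2 * (W z * ‖v z‖ ^ 2) := by ring
          _ ≤ _ := this
          _ = _ := by ring
    have e1 : ∫ z, (4 * (Sbot.indicator (fun _ => (D / (s₂ - s₁)) ^ 2) z * (W z * ‖v z‖ ^ 2)) +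
          4 * (Stop.indicator (fun _ => D ^ 2) z * (W z * ‖v z‖ ^ 2)) +
          2 * (Sann.indicator (fun _ => L ^ 2) z * (W z * ‖v z‖ ^ 2))) =
        (∫ z, (4 * (Sbot.indicator (fun _ => (D / (s₂ - s₁)) ^ 2) z * (W z * ‖v z‖ ^ 2)) +
          4 * (Stop.indicator (fun _ => D ^ 2) z * (W z * ‖v z‖ ^ 2)))) +
        ∫ z, 2 * (Sann.indicator (fun _ => L ^ 2) z * (W z * ‖v z‖ ^ 2)) :=
      integral_add ((i1.const_mul 4).add (i2.const_mul 4)) (i3.const_mul 2)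
    have e2 : ∫ z, (4 * (Sbot.indicator (fun _ => (D / (s₂ - s₁)) ^ 2) z * (W z * ‖v z‖ ^ 2)) +
          4 * (Stop.indicator (fun _ => D ^ 2) z * (W z * ‖v z‖ ^ 2))) =
        (∫ z, 4 * (Sbot.indicator (fun _ => (D / (s₂ - s₁)) ^ 2) z * (W z * ‖v z‖ ^ 2))) +
        ∫ z, 4 * (Stop.indicator (fun _ => D ^ 2) z * (W z * ‖v z‖ ^ 2)) :=
      integral_add (i1.const_mul 4) (i2.const_mul 4)
    have e3 : ∫ z, 4 * (Sbot.indicator (fun _ => (D / (s₂ - s₁)) ^ 2) z * (W z * ‖v z‖ ^ 2)) =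
        4 * ((D / (s₂ - s₁)) ^ 2 * Tbot) := by
      rw [integral_const_mul, integral_indicator_const_mul hbotm]
    have e4 : ∫ z, 4 * (Stop.indicator (fun _ => D ^ 2) z * (W z * ‖v z‖ ^ 2)) =
        4 * (D ^ 2 * Ttop) := by
      rw [integral_const_mul, integral_indicator_const_mul htopm]
    have e5 : ∫ z, 2 * (Sann.indicator (fun _ => L ^ 2) z * (W z * ‖v z‖ ^ 2)) =
        2 * (L ^ 2 * Tann1) := by
      rw [integral_const_mul, integral_indicator_const_mul hannm]
    rw [e1, e2, e3, e4, e5] at hmono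
    exact hmono
  -- ### (4) the region integrals are dominated by `U`
  have hIU : IntegrableOn (fun z => W z * (‖v z‖ ^ 2 + gradSq v z)) (Stop ∪ Sann) := by
    have := (hIvK.add hIgK).mono_set (union_subset htopK hannK)
    exact this.congr_fun (fun z _ => by simp only [Pi.add_apply]; ring) hunm
  have hle : ∀ {S : Set (ℝ × E)}, S ⊆ Stop ∪ Sann → MeasurableSet S →
      ∀ {q : ℝ × E → ℝ}, IntegrableOn (fun z => W z * q z) K → (∀ z, 0 ≤ q z) →
      (∀ z, q z ≤ ‖v z‖ ^ 2 + gradSq v z) → ∫ z in S, W z * q z ≤ U := by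
    intro S hS hSm q hq hq0 hq1
    have hSK : S ⊆ K := hS.trans (union_subset htopK hannK)
    calc ∫ z in S, W z * q z ≤ ∫ z in S, W z * (‖v z‖ ^ 2 + gradSq v z) :=
          setIntegral_mono_on (hq.mono_set hSK) (hIU.mono_set hS) hSm fun z hz =>
            mul_le_mul_of_nonneg_left (hq1 z) (hW0 z (hKΩ (hSK hz)))
      _ ≤ U := by
          refine setIntegral_mono_set hIU ?_ (Eventually.of_forall hS)
          refine ae_restrict_of_forall_mem hunm fun z hz => ?_
          exact mul_nonneg (hW0 z (hKΩ (union_subset htopK hannK hz)))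
            (add_nonneg (sq_nonneg _) (gradSq_nonneg v z))
  have hq1a : ∀ z, ‖v z‖ ^ 2 ≤ ‖v z‖ ^ 2 + gradSq v z := fun z =>
    le_add_of_nonneg_right (gradSq_nonneg v z)
  have hq1b : ∀ z, gradSq v z ≤ ‖v z‖ ^ 2 + gradSq v z := fun z =>
    le_add_of_nonneg_left (sq_nonneg _)
  have hTtopU : Ttop ≤ U := hle subset_union_left htopm hIvK (fun z => sq_nonneg _) hq1a
  have hTann1U : Tann1 ≤ U := hle subset_union_right hannm hIvK (fun z => sq_nonneg _) hq1a
  have hTann2U : Tann2 ≤ U := hle subset_union_right hannm hIgK (fun z => gradSq_nonneg v z) hq1b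
  -- nonnegativity of `Tbot`, `U`
  have hTbot0 : 0 ≤ Tbot := setIntegral_nonneg hbotm fun z hz =>
    mul_nonneg (hW0 z (hKΩ (hbotK hz))) (sq_nonneg _)
  have hU0 : 0 ≤ U := setIntegral_nonneg hunm fun z hz =>
    mul_nonneg (hW0 z (hKΩ (union_subset htopK hannK hz)))
      (add_nonneg (sq_nonneg _) (gradSq_nonneg v z))
  -- ### (5) assembly
  have hdiv : (D / (s₂ - s₁)) ^ 2 = D ^ 2 * (s₂ - s₁)⁻¹ ^ 2 := by
    rw [div_eq_mul_inv, mul_pow]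
  have h1 : G₀ * Tann1 ≤ G₀ * U := mul_le_mul_of_nonneg_left hTann1U hG₀
  have h2 : D ^ 2 * Ttop ≤ D ^ 2 * U := mul_le_mul_of_nonneg_left hTtopU (sq_nonneg _)
  have h3 : L ^ 2 * Tann1 ≤ L ^ 2 * U := mul_le_mul_of_nonneg_left hTann1U (sq_nonneg _)
  have h4 : G₀ * Tann2 ≤ G₀ * U := mul_le_mul_of_nonneg_left hTann2U hG₀
  have hX0 : 0 ≤ (s₂ - s₁)⁻¹ ^ 2 * Tbot := mul_nonneg (sq_nonneg _) hTbot0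
  have key1 : 24 * c₀ * (D ^ 2 * (s₂ - s₁)⁻¹ ^ 2 * Tbot) ≤
      (24 * c₀ * D ^ 2 + G₀ + 12 * c₀ * L ^ 2 + 24 * c₀ * G₀ + 1) * ((s₂ - s₁)⁻¹ ^ 2 * Tbot) := by
    rw [show 24 * c₀ * (D ^ 2 * (s₂ - s₁)⁻¹ ^ 2 * Tbot) =
      (24 * c₀ * D ^ 2) * ((s₂ - s₁)⁻¹ ^ 2 * Tbot) by ring]
    exact mul_le_mul_of_nonneg_right (by nlinarith [hc₀0.le, hG₀, sq_nonneg L]) hX0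
  have key2 : (24 * c₀ * D ^ 2 + G₀ + 12 * c₀ * L ^ 2 + 24 * c₀ * G₀) * U ≤
      (24 * c₀ * D ^ 2 + G₀ + 12 * c₀ * L ^ 2 + 24 * c₀ * G₀ + 1) * U :=
    mul_le_mul_of_nonneg_right (by linarith) hU0
  rw [hdiv] at hJ2
  have hJ2' := mul_le_mul_of_nonneg_left hJ2 (by positivity : (0 : ℝ) ≤ 6 * (11 * Real.exp (4 / 3)))
  have hJ3' := mul_le_mul_of_nonneg_left hJ3 (by positivity : (0 : ℝ) ≤ 24 * (11 * Real.exp (4 / 3)))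
  have h2' := mul_le_mul_of_nonneg_left h2 (by positivity : (0 : ℝ) ≤ 24 * c₀)
  have h3' := mul_le_mul_of_nonneg_left h3 (by positivity : (0 : ℝ) ≤ 12 * c₀)
  have h4' := mul_le_mul_of_nonneg_left h4 (by positivity : (0 : ℝ) ≤ 24 * c₀)
  simp only [← hc₀] at hJ2' hJ3' hmain
  linarith [hmain, hJ1, hJ2', hJ3', h1, h2', h3', h4', key1, key2]

end CoreFirst

end Carleman

end Literature.Analysis.FluidPDE
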